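import Summits.KontsevichZagierPeriods.KontsevichZagierPeriods.Statement
import Literature.NumberTheory.Transcendental.KZKernelConjectureForms
import Mathlib

/-!
# F4 ON-PATH LEMMA for the rung `NeronTorsionRealComponents` (line `NeronTorsionOval` on crux `TorsionSectorComplete`,
# stmt-KontsevichZagierPeriods-14212; forward generator G1, seed g1-KontsevichZagierPeriods-17981)

`theorem neronTorsionRealComponents_of_kontsevichZagierPeriods : KontsevichZagierPeriods → NeronTorsionRealComponents`
(S ⇒ rung), sorry-free, five lines per member: Conjecture 1 in kernel form (`kzKernelConjecture_iff_isRational`) and the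
value hypothesis of a tied element.  The rung is a consequence of S pinned at its other end to the proved floor
(F3 witness `Lines/NeronTorsionOval_special.lean`), which discharges the [nec]-trap: it is a consequence of S that is
NOT a consequence of the floor (kernel probe `floor → rung` open) and does NOT give S back (probe `rung → S` open; BC2).
Self-contained: verbatim copies of the two `def`s of `Lines/NeronTorsionOval.lean` in the namespace
`…NeronTorsionOval.OnPath` (the skeleton module carries the same theorem about the registered decl).
[cite: KontsevichZagier2001, §1.2 Conjecture 1]
-/

noncomputable section

-- `Summit.KontsevichZagierPeriods.KontsevichZagierPeriods.…` is the tree's mandated layout (single-conjunct summit).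
set_option linter.dupNamespace false

namespace Summit.KontsevichZagierPeriods.KontsevichZagierPeriods.Cruxes.TorsionSectorComplete.NeronTorsionOval.OnPath

open Literature.NumberTheory.Transcendental

/-- Verbatim copy of `Lines/NeronTorsionOval.lean :: NeronTorsionComponentSector`. -/
def NeronTorsionComponentSector : Bool → Prop
  | false => ∀ (g₂ g₃ e₁ xP yP α : ℝ) (N a : ℕ) (M k m : ℤ) (f : ℝ → ℝ), (∀ x, f x = 4 * x ^ 3 - g₂ * x - g₃) → g₂ ^ 3 - 27 * g₃ ^ 2 ≠ 0 → f e₁ = 0 → 0 < e₁ → (∀ x, e₁ < x → 0 < f x) → e₁ < xP → yP ^ 2 = f xP → 3 ≤ N → 0 < a → 2 * a < N → 4 * (N : ℤ) ^ 2 * k = M * ((N : ℤ) - 2 * (a : ℤ)) ^ 2 → (∀ hns : (⟨0, 0, 0, -g₂ / 4, -g₃ / 4⟩ : WeierstrassCurve ℝ).toAffine.Nonsingular xP (yP / 2), addOrderOf (WeierstrassCurve.Affine.Point.some xP (yP / 2) hns) = N) → (N : ℝ) * (∫ x in Set.Ioi xP, (Real.sqrt (f x))⁻¹) = a * (2 *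 ∫ x in Set.Ioi e₁, (Real.sqrt (f x))⁻¹) → 1 < α → ∀ (rI rP : Literature.NumberTheory.Transcendental.KZ.IntegralRep 2) (rL : Literature.NumberTheory.Transcendental.KZ.IntegralRep 1), rI.domain = {z | e₁ < z 1 ∧ z 1 < z 0 ∧ z 0 < xP} → Set.EqOn rI.integrand (fun z => z 1 / (Real.sqrt (f (z 1)) * Real.sqrt (f (z 0)))) rI.domain → rP.domain = {z | e₁ < z 0 ∧ e₁ < z 1} → Set.EqOn rP.integrand (fun z => (Real.sqrt (f (z 0)))⁻¹ * ((g₂ * z 1 + 2 * g₃) / (2 * (z 1) ^ 2 * Real.sqrt (f (z 1))))) rP.domain → rL.domain = {t | 1 < t 0 ∧ t 0 < α} → Set.EqOn rL.integrand (fun t => (t 0)⁻¹) rL.domain → (M : ℝ) * rI.value + k * rP.value = m * rL.value → M • Literature.NumberTheory.Transcendental.KZ.of rI + k • Literature.NumberTheory.Transcendental.KZ.of rP - m • Literature.NumberTheory.Transcendental.KZ.of rL ∈ Literature.NumberTheory.Transcendental.KZ.relations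
  | true => ∀ (g₂ g₃ e₂ e₃ xP yP α : ℝ) (N a : ℕ) (M k m : ℤ) (f : ℝ → ℝ), (∀ x, f x = 4 * x ^ 3 - g₂ * x - g₃) → g₂ ^ 3 - 27 * g₃ ^ 2 ≠ 0 → f e₃ = 0 → f e₂ = 0 → e₃ < e₂ → (∀ x, e₃ < x → x < e₂ → 0 < f x) → e₃ < xP → xP < e₂ → yP ^ 2 = f xP → 3 ≤ N → 0 < a → 2 * a < N → (N : ℤ) ^ 2 * k = M * (a : ℤ) ^ 2 → (∀ hns : (⟨0, 0, 0, -g₂ / 4, -g₃ / 4⟩ : WeierstrassCurve ℝ).toAffine.Nonsingular xP (yP / 2), addOrderOf (WeierstrassCurve.Affine.Point.some xP (yP / 2) hns) = N) → (N : ℝ) * (∫ x in Set.Ioo e₃ xP, (Real.sqrt (f x))⁻¹) = a * (2 * ∫ x in Set.Ioo e₃ e₂, (Real.sqrt (f x))⁻¹) → 1 < α → ∀ (rI rP : Literature.NumberTheory.Transcendental.KZ.IntegralRep 2) (rL : Literature.NumberTheory.Transcendental.KZ.IntegralRep 1), rI.domain = {z | e₃ < z 1 ∧ z 1 < z 0 ∧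 z 0 < xP} → Set.EqOn rI.integrand (fun z => z 1 / (Real.sqrt (f (z 1)) * Real.sqrt (f (z 0)))) rI.domain → rP.domain = {z | e₃ < z 0 ∧ z 0 < e₂ ∧ e₃ < z 1 ∧ z 1 < e₂} → Set.EqOn rP.integrand (fun z => (Real.sqrt (f (z 0)))⁻¹ * (-(2 * z 1) / Real.sqrt (f (z 1)))) rP.domain → rL.domain = {t | 1 < t 0 ∧ t 0 < α} → Set.EqOn rL.integrand (fun t => (t 0)⁻¹) rL.domain → (M : ℝ) * rI.value + k * rP.value = m * rL.value → M • Literature.NumberTheory.Transcendental.KZ.of rI + k • Literature.NumberTheory.Transcendental.KZ.of rP - m • Literature.NumberTheory.Transcendental.KZ.of rL ∈ Literature.NumberTheory.Transcendental.KZ.relations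

/-- Verbatim copy of `Lines/NeronTorsionOval.lean :: NeronTorsionRealComponents` (THE RUNG). -/
def NeronTorsionRealComponents : Prop := ∀ onOval : Bool, NeronTorsionComponentSector onOval

/-- **F4 on-path lemma, member by member:** the summit implies each member of the family. -/
@[simp] theorem neronTorsionComponentSector_of_kontsevichZagierPeriods (h : _root_.KontsevichZagierPeriods)
    (b : Bool) : NeronTorsionComponentSector b := by
  have hK : KZKernelConjecture := kzKernelConjecture_iff_isRational.mpr h
  cases b
  · intro g₂ g₃ e₁ xP yP α N a M k m f _ _ _ _ _ _ _ _ _ _ _ _ _ _ rI rP rL _ _ _ _ _ _ hval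
    apply hK
    rw [map_sub, map_add, map_zsmul, map_zsmul, map_zsmul, KZ.eval_of, KZ.eval_of, KZ.eval_of, zsmul_eq_mul,
      zsmul_eq_mul, zsmul_eq_mul]
    linarith [hval]
  · intro g₂ g₃ e₂ e₃ xP yP α N a M k m f _ _ _ _ _ _ _ _ _ _ _ _ _ _ _ _ rI rP rL _ _ _ _ _ _ hval
    apply hK
    rw [map_sub, map_add, map_zsmul, map_zsmul, map_zsmul, KZ.eval_of, KZ.eval_of, KZ.eval_of, zsmul_eq_mul,
      zsmul_eq_mul, zsmul_eq_mul]
    linarith [hval]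

/-- **F4 ON-PATH LEMMA — the summit implies the rung.** Tagged `@[simp]` so the tribunal's forward probe `S → Rung`
closes by `intro h; aesop` / `simp_all`. -/
@[simp] theorem neronTorsionRealComponents_of_kontsevichZagierPeriods (h : _root_.KontsevichZagierPeriods) :
    NeronTorsionRealComponents :=
  fun b => neronTorsionComponentSector_of_kontsevichZagierPeriods h b

end Summit.KontsevichZagierPeriods.KontsevichZagierPeriods.Cruxes.TorsionSectorComplete.NeronTorsionOval.OnPath

end
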